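import Mathlib
import Summits.KontsevichZagierPeriods.KontsevichZagierPeriods.Theorems.SoloInformedHookChart
import Summits.KontsevichZagierPeriods.KontsevichZagierPeriods.Theorems.SoloInformedHoffmanWord
import Summits.KontsevichZagierPeriods.KontsevichZagierPeriods.Theorems.SoloInformedHarmonicLabels
import HarnessLib
import HarnessLib.Audit

/-!
# SoloInformed — the hook identities: pull-back, dissection and the simplex pieces (LIII, F5b)

Solo programme `solo-KontsevichZagierPeriods-informed`, session s54.  Continues
`SoloInformedHookChart` (dimension `n = (m+1)+(i+1)`, `u` admissible of weight `m+1` with `k+1`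
blocks).  For ANY integral representation `r` on the source domain
`(0,1)ⁿ ∩ {y_i < x_0} ∩ {y_0 < ⋯ < y_i}` whose integrand is `G_u(Q_0(x),…,Q_k(x)) / ∏_j (1 − y_j)`
(`Q_t` the `u`-prefix products — this is the first A-side of the hook scale chain):

* the pull-back identity `r(x) = g(λ x)·|det J_λ(x)|`, hence (rule (2)) `[r] − [G] ∈ relations`
  with `G = [𝒢, g]` the garland representation, `g` integrable on `𝒢` by transport from `r`;
* the order-cell dissection `[G] − ∑_{σ ⊨ E} [G|_{C_σ}] ∈ relations` (THM XXXVIII);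
* every simplex piece is a multiple zeta value: `⟦G|_{C_σ}⟧ = mzvClass (idx_σ)`, `idx_σ` the index of
  the word READ ALONG `σ` (letters `ε(u)` on the chain, `1` on the bullets; the top slot holds `x_0`,
  the bottom slot a minimal vertex, so the word is admissible);
* **`⟦r⟧ = ∑_{σ ⊨ E} mzvClass (idx_σ)`** — Yamamoto's integral of the hook 2-poset as a sum over
  its linear extensions, in `𝒫 = FormalPeriodRing`.

Place in the programme (the files that consume this one): `SoloInformedHookColour` and
`SoloInformedHookShuffle` rewrite the `σ`-sum as the shuffle sum of Kaneko–Yamamoto's left-hand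
side; `SoloInformedHookBase` supplies the initial stage of the hook scale chain whose `A`-side
representation is an `r` as above, and `SoloInformedHook` assembles the hook identities in `𝒫`.

References: S. Yamamoto, arXiv:1405.6499 Thm 1.2; M. Kaneko, S. Yamamoto, arXiv:1605.03117 §4;
Kontsevich–Zagier 2001 §1.2.
-/

noncomputable section

open MeasureTheory Set MvPolynomial
open Literature.ModelTheory.ExponentialFields Literature.NumberTheory.Transcendental
open Literature.NumberTheory.Transcendental.KZ

namespace Summit.KontsevichZagierPeriods.KontsevichZagierPeriods.Theorems

variable {m i : ℕ}

/-! ## 0. The pull-back identity and the garland representation -/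

section pullback

variable {u : List ℕ} {k : ℕ} (hu : MZV.IsAdmissible u) (hw : MZV.weight u = m + 1)
  (hk : u.length = k + 1)
include hu hw hk

/-- The `u`-prefix product `Q_r` is the prefix product of the chain part at `J_{r+1} − 1`. -/
theorem soloInformed_QU_eq_PP_castAdd (x : Fin (m + 1 + (i + 1)) → ℝ) {r : ℕ} (hr : r ≤ k) :
    soloInformedQU (m + 1 + i) u x r =
      soloInformedPP (fun j' : Fin (m + 1) => x (Fin.castAdd (i + 1) j'))
        ((soloInformedEnds u).getD r 0 - 1) := by
  have h1 := soloInformed_one_le_ends_getD hu.1 (show r < u.length by omega)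
  have h2 := soloInformed_ends_getD_le_weight hu.1 hw hk r
  unfold soloInformedQU soloInformedPP
  have h : Finset.univ.filter (fun l : Fin (m + 1 + i + 1) => l.1 < (soloInformedEnds u).getD r 0) =
      (Finset.univ.filter (fun j' : Fin (m + 1) => j'.1 ≤ (soloInformedEnds u).getD r 0 - 1)).map
        ⟨Fin.castAdd (i + 1), Fin.castAdd_injective _ _⟩ := by
    ext l
    simp only [Finset.mem_filter, Finset.mem_univ, true_and, Finset.mem_map,
      Function.Embedding.coeFn_mk]
    constructor
    · intro hl
      exact ⟨⟨l, by omega⟩, by simp only; omega, Fin.ext rfl⟩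
    · rintro ⟨j', hj', rfl⟩
      simp only [Fin.val_castAdd]
      omega
  rw [h, Finset.prod_map]
  rfl

/-- The integrand of the first A-side of the hook chain. -/
def soloInformedHookAf (u : List ℕ) (k m i : ℕ) (x : Fin (m + 1 + (i + 1)) → ℝ) : ℝ :=
  soloInformedGQ (List.ofFn fun t : Fin (k + 1) => soloInformedQU (m + 1 + i) u x t) /
    ∏ j : Fin (i + 1), (1 - x (Fin.natAdd (m + 1) j))

/-- **The pull-back identity** `A(x) = g(λ x) · |det J_λ(x)|` on the cube. -/
theorem soloInformed_hookAf_lam {x : Fin (m + 1 + (i + 1)) → ℝ}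
    (hx : x ∈ soloInformedOpenCube (m + 1 + (i + 1))) :
    soloInformedHookAf u k m i x =
      soloInformedHookG u m i (soloInformedHookLam m i x) *
        |(soloInformedJacCLM (soloInformedHookLamPoly m i) x).det| := by
  have hD := soloInformed_det_hookLam_pos hx
  have hxc : (fun j' : Fin (m + 1) => x (Fin.castAdd (i + 1) j')) ∈ soloInformedOpenCube (m + 1) :=
    fun j' => hx _
  have hGQ : soloInformedGQ (List.ofFn fun t : Fin (k + 1) => soloInformedQU (m + 1 + i) u x t) =
      soloInformedCubeWf (soloInformedWordFn u m) (fun j' : Fin (m + 1) => x (Fin.castAdd (i + 1) j')) := by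
    rw [soloInformed_cubeWf_eq_GQ hu.1 hw hk]
    congr 1
    exact List.ofFn_inj.2 (funext fun r => soloInformed_QU_eq_PP_castAdd hu hw hk x (by omega))
  have hmul := soloInformed_word_mul (soloInformedWordFn u m) (soloInformed_wordFn_last hu hw)
    (fun j => soloInformedPrefixProd (fun j' : Fin (m + 1) => x (Fin.castAdd (i + 1) j')) j)
    fun j => (soloInformed_prefixProd_pos hxc j).ne'
  rw [soloInformedHookAf, hGQ, soloInformedCubeWf, ← hmul, abs_of_pos hD, soloInformed_det_hookLam,
    soloInformedHookG_eq, div_eq_mul_inv]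
  simp only [soloInformedHookLam_castAdd, soloInformedHookLam_natAdd, one_div, Finset.prod_inv_distrib]
  ring

/-- Integrability of `g` on `𝒢`, transported along `λ` from a representation on the source. -/
theorem soloInformed_integrableOn_hookG (r : IntegralRep (m + 1 + (i + 1)))
    (hd : r.domain = soloInformedHookA m i)
    (hi : ∀ x ∈ soloInformedHookA m i, r.integrand x = soloInformedHookAf u k m i x) :
    IntegrableOn (soloInformedHookG u m i) (soloInformedHookGarland m i) := by
  rw [← soloInformed_image_hookLam, soloInformedHookLam, soloInformed_integrableOn_image_polyMap_iff _
    soloInformed_measurableSet_hookA (soloInformed_injOn_hookLam.mono fun x hx => hx.1.1)]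
  have h := r.integrableOn
  rw [hd] at h
  refine h.congr_fun (fun x hx => ?_) soloInformed_measurableSet_hookA
  rw [hi x hx, soloInformed_hookAf_lam hu hw hk hx.1.1, mul_comm]
  rfl

omit hu hw hk in
/-- The garland representation `G = [𝒢, g]` (integrability supplied). -/
def soloInformedHookGRep (u : List ℕ) (m i : ℕ)
    (hg : IntegrableOn (soloInformedHookG u m i) (soloInformedHookGarland m i)) :
    IntegralRep (m + 1 + (i + 1)) where
  domain := soloInformedHookGarland m i
  integrand := soloInformedHookG u m i
  isSemialgebraic_domain := soloInformed_isSemialgebraic_hookGarland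
  isSemialgebraicFunOn_integrand :=
    soloInformed_isSemialgebraicFunOn_quot soloInformed_isSemialgebraic_hookGarland 1
      (soloInformedHookDen u m i) _ (fun t ht => (soloInformed_hookDen_pos u ht.1).ne')
      fun t _ => by rw [soloInformedHookG_eq_div, map_one]
  integrableOn := hg

omit hu hw hk in
/-- Auxiliary (hook pieces): `soloInformedHookGRep_domain`. -/
@[simp] theorem soloInformedHookGRep_domain
    (hg : IntegrableOn (soloInformedHookG u m i) (soloInformedHookGarland m i)) :
    (soloInformedHookGRep u m i hg).domain = soloInformedHookGarland m i := rfl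

omit hu hw hk in
/-- Auxiliary (hook pieces): `soloInformedHookGRep_integrand`. -/
@[simp] theorem soloInformedHookGRep_integrand
    (hg : IntegrableOn (soloInformedHookG u m i) (soloInformedHookGarland m i)) :
    (soloInformedHookGRep u m i hg).integrand = soloInformedHookG u m i := rfl

/-- **MOVE A (rule (2) along `λ`)**: `[r] − [G] ∈ relations`. -/
theorem soloInformed_hook_moveA (r : IntegralRep (m + 1 + (i + 1)))
    (hd : r.domain = soloInformedHookA m i)
    (hi : ∀ x ∈ soloInformedHookA m i, r.integrand x = soloInformedHookAf u k m i x) :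
    of r - of (soloInformedHookGRep u m i (soloInformed_integrableOn_hookG hu hw hk r hd hi)) ∈
      relations := by
  refine soloInformed_of_sub_of_mem_relations_polyMapCLM (soloInformedHookLamPoly m i) r _ ?_ ?_
    fun x hx => ?_
  · rw [hd]; exact soloInformed_injOn_hookLam.mono fun x hx => hx.1.1
  · rw [hd]; exact soloInformed_image_hookLam.symm
  · rw [hd] at hx
    rw [hi x hx]
    exact soloInformed_hookAf_lam hu hw hk hx.1.1

omit hu hw hk in
/-- **`[G] − ∑_{σ ⊨ E} [G|_{C_σ}] ∈ relations`** (engine THM XXXVIII). -/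
theorem soloInformed_hookG_dissect
    (hg : IntegrableOn (soloInformedHookG u m i) (soloInformedHookGarland m i)) :
    of (soloInformedHookGRep u m i hg) -
      ∑ σ ∈ Finset.univ.filter (soloInformedCompat (soloInformedHookPoset m i)),
        of (soloInformedCellRep (soloInformedHookGRep u m i hg) σ) ∈ relations :=
  soloInformed_of_sub_sum_linext _ (soloInformedHookPoset m i) inter_subset_right _
    fun _ hσ => Finset.mem_filter.2 ⟨Finset.mem_univ _, hσ⟩

end pullback

/-! ## 1. Linear extensions of the hook poset: the top and the bottom slot -/

/-- A pair of the poset orders the slots. -/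
theorem soloInformed_hookCompat_lt {σ : Equiv.Perm (Fin (m + 1 + (i + 1)))}
    (hσ : soloInformedCompat (soloInformedHookPoset m i) σ) {a b : Fin (m + 1 + (i + 1))}
    (h : (a, b) ∈ soloInformedHookPoset m i) :
    soloInformedCellPerm σ b < soloInformedCellPerm σ a :=
  Fin.rev_lt_rev.2 (hσ (a, b) h)

/-- The chain pair `(x_{j+1}, x_j)` is in the poset. -/
theorem soloInformed_mem_hookPoset_chain (j : Fin m) :
    (Fin.castAdd (i + 1) j.succ, Fin.castAdd (i + 1) (Fin.castSucc j)) ∈ soloInformedHookPoset m i :=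
  List.mem_append_left _ (List.mem_map.2 ⟨j, List.mem_finRange j, rfl⟩)

/-- The top pair `(y_i, x_0)` is in the poset. -/
theorem soloInformed_mem_hookPoset_top :
    (Fin.natAdd (m + 1) (Fin.last i), Fin.castAdd (i + 1) 0) ∈ soloInformedHookPoset m i :=
  List.mem_append_right _ (List.mem_cons.2 (Or.inl rfl))

/-- The bullet pair `(y_j, y_{j+1})` is in the poset. -/
theorem soloInformed_mem_hookPoset_bullet (j : Fin i) :
    (Fin.natAdd (m + 1) (Fin.castSucc j), Fin.natAdd (m + 1) j.succ) ∈ soloInformedHookPoset m i :=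
  List.mem_append_right _ (List.mem_cons.2 (Or.inr (List.mem_map.2 ⟨j, List.mem_finRange j, rfl⟩)))

/-- **Only `x_0` can sit at the top slot.** -/
theorem soloInformed_hookCompat_symm_zero {σ : Equiv.Perm (Fin (m + 1 + (i + 1)))}
    (hσ : soloInformedCompat (soloInformedHookPoset m i) σ) :
    (soloInformedCellPerm σ).symm 0 = Fin.castAdd (i + 1) 0 := by
  obtain ⟨c, hc⟩ := (soloInformedCellPerm σ).surjective 0
  have key : ∀ c : Fin (m + 1 + (i + 1)), c ≠ Fin.castAdd (i + 1) 0 → soloInformedCellPerm σ c ≠ 0 := by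
    intro c hc
    induction c using Fin.addCases with
    | left j' =>
      have hj' : j' ≠ 0 := fun h => hc (by rw [h])
      obtain ⟨j, rfl⟩ : ∃ j : Fin m, j' = j.succ := ⟨j'.pred hj', (Fin.succ_pred j' hj').symm⟩
      exact (lt_of_le_of_lt (Fin.zero_le _)
        (soloInformed_hookCompat_lt hσ (soloInformed_mem_hookPoset_chain j))).ne'
    | right j =>
      rcases Fin.eq_castSucc_or_eq_last j with ⟨j, rfl⟩ | rfl
      · exact (lt_of_le_of_lt (Fin.zero_le _)
          (soloInformed_hookCompat_lt hσ (soloInformed_mem_hookPoset_bullet j))).ne'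
      · exact (lt_of_le_of_lt (Fin.zero_le _)
          (soloInformed_hookCompat_lt hσ soloInformed_mem_hookPoset_top)).ne'
  have hc' : c = Fin.castAdd (i + 1) 0 := by
    by_contra h
    exact key c h hc
  rw [← hc, Equiv.symm_apply_apply]
  exact hc'

/-- **Only a minimal vertex (`x_m` or `y_0`) can sit at the bottom slot.** -/
theorem soloInformed_hookCompat_symm_last {σ : Equiv.Perm (Fin (m + 1 + (i + 1)))}
    (hσ : soloInformedCompat (soloInformedHookPoset m i) σ) :
    (soloInformedCellPerm σ).symm (Fin.last (m + 1 + i)) = Fin.castAdd (i + 1) (Fin.last m) ∨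
      (soloInformedCellPerm σ).symm (Fin.last (m + 1 + i)) = Fin.natAdd (m + 1) 0 := by
  obtain ⟨c, hc⟩ := (soloInformedCellPerm σ).surjective (Fin.last (m + 1 + i))
  have key : ∀ c : Fin (m + 1 + (i + 1)), c ≠ Fin.castAdd (i + 1) (Fin.last m) →
      c ≠ Fin.natAdd (m + 1) 0 → soloInformedCellPerm σ c ≠ Fin.last (m + 1 + i) := by
    intro c hc1 hc2
    induction c using Fin.addCases with
    | left j' =>
      have hj' : j' ≠ Fin.last m := fun h => hc1 (by rw [h])
      obtain ⟨j, rfl⟩ : ∃ j : Fin m, j' = Fin.castSucc j :=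
        ⟨j'.castPred hj', (Fin.castSucc_castPred j' hj').symm⟩
      exact (lt_of_lt_of_le (soloInformed_hookCompat_lt hσ (soloInformed_mem_hookPoset_chain j))
        (Fin.le_last _)).ne
    | right j =>
      have hj : j ≠ 0 := fun h => hc2 (by rw [h])
      obtain ⟨j'', rfl⟩ : ∃ j'' : Fin i, j = j''.succ := ⟨j.pred hj, (Fin.succ_pred j hj).symm⟩
      exact (lt_of_lt_of_le (soloInformed_hookCompat_lt hσ (soloInformed_mem_hookPoset_bullet j''))
        (Fin.le_last _)).ne
  have hc' : c = Fin.castAdd (i + 1) (Fin.last m) ∨ c = Fin.natAdd (m + 1) 0 := by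
    by_contra h
    exact key c (not_or.1 h).1 (not_or.1 h).2 hc
  rw [← hc, Equiv.symm_apply_apply]
  exact hc'

/-! ## 2. The word read along a linear extension and the class of its simplex piece -/

/-- The letter at slot `p`: the letter of the coordinate that `σ` puts there. -/
def soloInformedHookLetter (u : List ℕ) (m i : ℕ) (σ : Equiv.Perm (Fin (m + 1 + (i + 1))))
    (p : Fin (m + 1 + (i + 1))) : Bool :=
  soloInformedHookEps u m i ((soloInformedCellPerm σ).symm p)

/-- The binary word read along `σ` (top slot first). -/
def soloInformedHookWordσ (u : List ℕ) (m i : ℕ) (σ : Equiv.Perm (Fin (m + 1 + (i + 1)))) : List Bool :=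
  List.ofFn (soloInformedHookLetter u m i σ)

/-- The index attached to `σ`. -/
def soloInformedHookIdxσ (u : List ℕ) (m i : ℕ) (σ : Equiv.Perm (Fin (m + 1 + (i + 1)))) : List ℕ :=
  MZV.ofBinaryWord (soloInformedHookWordσ u m i σ)

section pieces

variable {u : List ℕ} {k : ℕ} (hu : MZV.IsAdmissible u) (hw : MZV.weight u = m + 1)

/-- The word read along `σ` is nonempty. -/
theorem soloInformed_hookWordσ_ne_nil (σ : Equiv.Perm (Fin (m + 1 + (i + 1)))) :
    soloInformedHookWordσ u m i σ ≠ [] := by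
  rw [Ne, ← List.length_eq_zero_iff, soloInformedHookWordσ, List.length_ofFn]
  omega

/-- `getD` of the word at a `Fin` slot is the letter. -/
theorem soloInformed_hookWordσ_getD (σ : Equiv.Perm (Fin (m + 1 + (i + 1)))) (p : Fin (m + 1 + (i + 1))) :
    (soloInformedHookWordσ u m i σ).getD p false = soloInformedHookLetter u m i σ p := by
  rw [soloInformedHookWordσ, List.getD_eq_getElem?_getD, List.getElem?_ofFn]
  simp [p.2]

include hu hw

/-- For a linear extension the word does not start with `1` (the top slot holds `x_0`, `u_0 ≥ 2`). -/
theorem soloInformed_hookWordσ_head {σ : Equiv.Perm (Fin (m + 1 + (i + 1)))}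
    (hσ : soloInformedCompat (soloInformedHookPoset m i) σ) :
    (soloInformedHookWordσ u m i σ).head? ≠ some true := by
  rw [soloInformedHookWordσ, List.ofFn_succ, List.head?_cons, soloInformedHookLetter,
    soloInformed_hookCompat_symm_zero hσ, soloInformedHookEps_castAdd, soloInformed_wordFn_zero hu hw]
  simp

/-- For a linear extension the word ends with `1` (the bottom slot holds `x_m` or `y_0`). -/
theorem soloInformed_hookWordσ_getLast {σ : Equiv.Perm (Fin (m + 1 + (i + 1)))}
    (hσ : soloInformedCompat (soloInformedHookPoset m i) σ) :
    (soloInformedHookWordσ u m i σ).getLast? = some true := by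
  rw [soloInformedHookWordσ, List.ofFn_succ', List.concat_eq_append, List.getLast?_append,
    List.getLast?_singleton, Option.some_or]
  congr 1
  rw [soloInformedHookLetter]
  show soloInformedHookEps u m i ((soloInformedCellPerm σ).symm (Fin.last (m + 1 + i))) = true
  rcases soloInformed_hookCompat_symm_last hσ with h | h
  · rw [h, soloInformedHookEps_castAdd, soloInformed_wordFn_last hu hw]
  · rw [h, soloInformedHookEps_natAdd]

/-- **The index attached to a linear extension is admissible.** -/
theorem soloInformed_hookIdxσ_admissible {σ : Equiv.Perm (Fin (m + 1 + (i + 1)))}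
    (hσ : soloInformedCompat (soloInformedHookPoset m i) σ) :
    MZV.IsAdmissible (soloInformedHookIdxσ u m i σ) :=
  MZV.isAdmissible_ofBinaryWord (soloInformed_hookWordσ_head hu hw hσ)

/-- **The attached index has weight `n`.** -/
theorem soloInformed_hookIdxσ_weight {σ : Equiv.Perm (Fin (m + 1 + (i + 1)))}
    (hσ : soloInformedCompat (soloInformedHookPoset m i) σ) :
    MZV.weight (soloInformedHookIdxσ u m i σ) = m + 1 + (i + 1) := by
  rw [soloInformedHookIdxσ, MZV.weight_ofBinaryWord (soloInformed_hookWordσ_ne_nil σ)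
    (soloInformed_hookWordσ_getLast hu hw hσ), soloInformedHookWordσ, List.length_ofFn]

/-- The letters of the attached index are the letters read along `σ`. -/
theorem soloInformed_hookIdxσ_getD {σ : Equiv.Perm (Fin (m + 1 + (i + 1)))}
    (hσ : soloInformedCompat (soloInformedHookPoset m i) σ) (p : Fin (m + 1 + (i + 1))) :
    (MZV.binaryWord (soloInformedHookIdxσ u m i σ)).getD p false = soloInformedHookLetter u m i σ p := by
  rw [soloInformedHookIdxσ, MZV.binaryWord_ofBinaryWord (soloInformed_hookWordσ_ne_nil σ)
    (soloInformed_hookWordσ_getLast hu hw hσ), soloInformed_hookWordσ_getD]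

variable (hg : IntegrableOn (soloInformedHookG u m i) (soloInformedHookGarland m i))

omit hu hw in
/-- The simplex piece of a linear extension lives on Kontsevich's simplex. -/
theorem soloInformed_hookPiece_domain {σ : Equiv.Perm (Fin (m + 1 + (i + 1)))}
    (hσ : soloInformedCompat (soloInformedHookPoset m i) σ) :
    ((soloInformedCellRep (soloInformedHookGRep u m i hg) σ).reindex (soloInformedCellPerm σ)).domain =
      openOrderedSimplex (m + 1 + (i + 1)) :=
  soloInformed_reindex_cubeCell_domain _ σ (by
    rw [soloInformedCellRep_domain, soloInformedHookGRep_domain, soloInformedHookGarland]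
    exact soloInformed_inter_orderSet_inter_cell hσ _)

/-- **The integrand of the simplex piece of `σ`** is the word-product of the attached index. -/
theorem soloInformed_hookPiece_integrand {σ : Equiv.Perm (Fin (m + 1 + (i + 1)))}
    (hσ : soloInformedCompat (soloInformedHookPoset m i) σ) (w : Fin (m + 1 + (i + 1)) → ℝ) :
    ((soloInformedCellRep (soloInformedHookGRep u m i hg) σ).reindex (soloInformedCellPerm σ)).integrand w =
      ∏ p : Fin (m + 1 + (i + 1)),
        mzvForm ((MZV.binaryWord (soloInformedHookIdxσ u m i σ)).getD p false) (w p) := by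
  show soloInformedHookG u m i (fun l => w (soloInformedCellPerm σ l)) = _
  unfold soloInformedHookG
  simp only [soloInformed_hookIdxσ_getD hu hw hσ, soloInformedHookLetter]
  rw [← Equiv.prod_comp (soloInformedCellPerm σ) (fun p : Fin (m + 1 + (i + 1)) => mzvForm
    (soloInformedHookEps u m i ((soloInformedCellPerm σ).symm p)) (w p))]
  simp only [Equiv.symm_apply_apply]

/-- **Each simplex piece IS a multiple zeta class**: `⟦(G|_{C_σ}) ∘ cellPerm σ⟧ = mzvClass (idx_σ)`. -/
theorem soloInformed_hookPiece_class {σ : Equiv.Perm (Fin (m + 1 + (i + 1)))}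
    (hσ : soloInformedCompat (soloInformedHookPoset m i) σ) :
    toFormalPeriod (of ((soloInformedCellRep (soloInformedHookGRep u m i hg) σ).reindex
      (soloInformedCellPerm σ))) = mzvClass (soloInformedHookIdxσ u m i σ) :=
  soloInformed_toFormalPeriod_eq_mzvClass (soloInformed_hookIdxσ_admissible hu hw hσ)
    (soloInformed_hookIdxσ_weight hu hw hσ) _ (soloInformed_hookPiece_domain hg hσ)
    (soloInformed_hookPiece_integrand hu hw hg hσ)

/-- The cell piece itself has the same class (rule (2) along the sorting permutation). -/
theorem soloInformed_hookCellRep_class {σ : Equiv.Perm (Fin (m + 1 + (i + 1)))}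
    (hσ : soloInformedCompat (soloInformedHookPoset m i) σ) :
    toFormalPeriod (of (soloInformedCellRep (soloInformedHookGRep u m i hg) σ)) =
      mzvClass (soloInformedHookIdxσ u m i σ) := by
  rw [← soloInformed_hookPiece_class hu hw hg hσ, toFormalPeriod_eq_iff]
  exact of_sub_of_reindex_mem_relations _ _

end pieces

/-! ## 3. The integral side of the hook identity as a sum over linear extensions -/

/-- **THEOREM (LIII, integral side).**  For every representation `r` on
`(0,1)ⁿ ∩ {y_i < x_0} ∩ {y_0 < ⋯ < y_i}` with integrand `G_u(Q(x)) / ∏_j (1 − y_j)`: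
`⟦r⟧ = ∑_{σ ⊨ E} mzvClass (idx_σ)` — Yamamoto's integral of the hook 2-poset `μ(u, (1^{i+1}))`
evaluated as the sum of the multiple zeta values of its linear extensions, in `𝒫`. -/
theorem soloInformed_hook_integral_class {u : List ℕ} {k : ℕ} (hu : MZV.IsAdmissible u)
    (hw : MZV.weight u = m + 1) (hk : u.length = k + 1) (r : IntegralRep (m + 1 + (i + 1)))
    (hd : r.domain = soloInformedHookA m i)
    (hi : ∀ x ∈ soloInformedHookA m i, r.integrand x = soloInformedHookAf u k m i x) :
    toFormalPeriod (of r) =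
      ∑ σ ∈ Finset.univ.filter (soloInformedCompat (soloInformedHookPoset m i)),
        mzvClass (soloInformedHookIdxσ u m i σ) := by
  have hg := soloInformed_integrableOn_hookG hu hw hk r hd hi
  rw [toFormalPeriod_eq_iff.2 (soloInformed_hook_moveA hu hw hk r hd hi),
    toFormalPeriod_eq_iff.2 (soloInformed_hookG_dissect hg), map_sum]
  exact Finset.sum_congr rfl fun σ hσ =>
    soloInformed_hookCellRep_class hu hw hg (Finset.mem_filter.1 hσ).2

end Summit.KontsevichZagierPeriods.KontsevichZagierPeriods.Theorems
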